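import Literature.Probability.RandomPlanarGeometry.CLE
import Literature.Probability.RandomPlanarGeometry.ModularLoopEnsembleLaw
import Literature.Probability.RandomPlanarGeometry.ConformalMapRiemannProofs
import Literature.Probability.RandomPlanarGeometry.ConformalMapCaratheodoryProofs
import Literature.Probability.RandomPlanarGeometry.JordanDomainProofs
import Literature.Probability.RandomPlanarGeometry.UpperHalfPlaneAutomorphisms
import HarnessLib

/-!
# Discharge of `exists_isCLEFamily`: an explicit Möbius-invariant loop ensemble

This file proves the named fact `Literature.Probability.RandomPlanarGeometry.exists_isCLEFamily` of
`CLE.lean` (`exists_isCLEFamily_holds`): for every `κ ∈ (8/3, 8)` there is a family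
`μ : JordanDomain → Measure (LoopSpace ℂ)` satisfying the hypothesis structure `IsCLEFamily κ μ`.

## Honesty

`IsCLEFamily` is the v0 axiomatics of `CLE.lean`: `κ` only gates the simple-loop field, the
restriction (domain Markov) field is a conditional-on-positive-probability placeholder, and no
classification is stated. The witness built here is **not** Sheffield's `CLE_κ` (Duke Math. J. 147
(2009), Thm 1.1), which has not been constructed in Lean; it is the *modular loop ensemble*: the
`SL(2, ℤ)`-translates of the boundaries of the dyadic squares in the open fundamental domain of the
modular group, moved by a Haar-uniform element of `SL(2, ℤ) \ SL(2, ℝ)`, read in the disc through the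
Cayley transform and transported to a Jordan domain `D` by a Riemann map (Riemann mapping theorem,
`exists_conformalEquiv_ball_holds`) extended to the closed disc (Carathéodory's theorem,
`JordanDomain.exists_continuousOn_extension_holds`). It satisfies every field of `IsCLEFamily κ` for every
`κ`: its loops are simple, countable, locally finite, pairwise non-crossing and infinite in number; its
law is conformally invariant because the law on the disc is invariant under all disc automorphisms
(`map_modularLaw_eq`, unimodularity of `SL(2, ℝ)` and `Aut(𝔻) = PSU(1,1)`,
`ConformalEquiv.exists_specialLinearGroup_eq`); and the v0 restriction field holds because for a proper
Jordan subdomain `D' ⊊ D` the event "no loop meets `∂D'`" is null (almost surely an arc of `∂D' ∩ D`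
passes through an open tile and is crossed by arbitrarily fine square loops), while for `D' = D` (same
carrier) every loop avoids `∂D` and the window restriction is the identity. That such a family
exists shows, in Lean, how much weaker the v0 structure is than CLE (as its docstring warns).

## Contents

* `unifMap S`, `unifExt S`, `unifExtC S`: a Riemann map `𝔻 → S` of a Jordan carrier `S`, its
  Carathéodory extension, and the uniformly continuous extension to `ℂ` (radial retraction).
* `cleLaw D := cleLawOf D.carrier _ = modularLaw.map (LoopSpace.map (unifExtC D.carrier))`; the fields
  of `IsCLEFamily` (`isCLEFamily_cleLaw`) and `exists_isCLEFamily_holds`. The law depends on `D` only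
  through its carrier (`IsJordanCarrier`, `cleLawOf`, `cleLawOf_congr`): the v0 restriction field compares
  `μ D` with `μ D'` whenever `D'.carrier ⊆ D.carrier`, in particular for two Jordan-domain structures with
  the same carrier, where it reduces to `μ D = μ D'` (`restriction_of_carrier_eq`).

## References

* S. Sheffield, *Exploration trees and conformal loop ensembles*, Duke Math. J. 147 (2009), Thm 1.1,
  §1.1 (the axioms; the fact discharged).
* S. Sheffield, W. Werner, *Conformal loop ensembles: the Markovian characterization and the
  loop-soup construction*, Ann. of Math. 176 (2012), §2.1.
-/

noncomputable section

open Set Filter Topology MeasureTheory Metric Complex UpperHalfPlane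
open scoped MatrixGroups Modular ENNReal NNReal

namespace Literature.Probability.RandomPlanarGeometry

namespace ModularEnsemble

/-! ### Uniformisation data of a Jordan carrier -/

/-- A set is a *Jordan carrier* if it is the carrier of some Jordan domain. [folklore] -/
def IsJordanCarrier (S : Set ℂ) : Prop := ∃ D : JordanDomain, D.carrier = S

/-- The carrier of a Jordan domain is a Jordan carrier. [folklore] -/
lemma isJordanCarrier_carrier (D : JordanDomain) : IsJordanCarrier D.carrier := ⟨D, rfl⟩

/-- **Uniformisation of a Jordan carrier**: a conformal map of the disc onto `S` (Riemann mapping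
theorem, `exists_conformalEquiv_ball_holds`; Jordan domains are simply connected,
`JordanDomain.isSimplyConnected_holds`) together with its Carathéodory extension to the closed disc
(`JordanDomain.exists_continuousOn_extension_holds`): a continuous bijection of the closed disc onto
`closure S` taking the circle onto `frontier S`. [folklore] -/
theorem exists_unifData (S : Set ℂ) (hS : IsJordanCarrier S) :
    ∃ d : ConformalEquiv (ball (0 : ℂ) 1) S × (ℂ → ℂ),
      ContinuousOn d.2 (closedBall 0 1) ∧ EqOn d.2 d.1 (ball 0 1) ∧
        BijOn d.2 (closedBall 0 1) (closure S) ∧ BijOn d.2 (sphere 0 1) (frontier S) := by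
  obtain ⟨D, rfl⟩ := hS
  obtain ⟨φ⟩ := exists_conformalEquiv_ball_holds D.isOpen D.isSimplyConnected_holds D.carrier_ne_univ
  obtain ⟨Φ, h1, h2, h3, h4⟩ := JordanDomain.exists_continuousOn_extension_holds D φ.symm
  exact ⟨(φ.symm, Φ), h1, h2, h3, h4⟩

variable (S : Set ℂ) (hS : IsJordanCarrier S)

/-- A Riemann map of the unit disc onto the Jordan carrier `S`. [folklore] -/
def unifMap : ConformalEquiv (ball (0 : ℂ) 1) S := (Classical.choose (exists_unifData S hS)).1

/-- The Carathéodory extension of `unifMap S` to the closed disc (junk outside). [folklore] -/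
def unifExt : ℂ → ℂ := (Classical.choose (exists_unifData S hS)).2

/-- The extension is continuous on the closed disc. [folklore] -/
lemma continuousOn_unifExt : ContinuousOn (unifExt S hS) (closedBall 0 1) :=
  (Classical.choose_spec (exists_unifData S hS)).1

/-- The extension agrees with the Riemann map on the open disc. [folklore] -/
lemma unifExt_eqOn : EqOn (unifExt S hS) (unifMap S hS) (ball 0 1) :=
  (Classical.choose_spec (exists_unifData S hS)).2.1

/-- The extension is a bijection of the closed disc onto `closure S`. [folklore] -/
lemma bijOn_unifExt : BijOn (unifExt S hS) (closedBall 0 1) (closure S) :=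
  (Classical.choose_spec (exists_unifData S hS)).2.2.1

/-- The extension is a bijection of the circle onto `frontier S`. [folklore] -/
lemma bijOn_unifExt_sphere : BijOn (unifExt S hS) (sphere 0 1) (frontier S) :=
  (Classical.choose_spec (exists_unifData S hS)).2.2.2

/-- **The uniformising map extended to `ℂ`**: Carathéodory extension precomposed with the radial
retraction; uniformly continuous on `ℂ`. [folklore] -/
def unifExtC : C(ℂ, ℂ) :=
  ⟨unifExt S hS ∘ radialRetr, continuous_comp_radialRetr (continuousOn_unifExt S hS)⟩

/-- `unifExtC` is uniformly continuous. [folklore] -/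
lemma uniformContinuous_unifExtC : UniformContinuous (unifExtC S hS) :=
  uniformContinuous_comp_radialRetr (continuousOn_unifExt S hS)

/-- Pointwise formula. [folklore] -/
lemma unifExtC_apply (w : ℂ) : unifExtC S hS w = unifExt S hS (radialRetr w) := rfl

/-- On the closed disc `unifExtC` is the Carathéodory extension. [folklore] -/
lemma unifExtC_of_norm_le_one {w : ℂ} (hw : ‖w‖ ≤ 1) : unifExtC S hS w = unifExt S hS w := by
  rw [unifExtC_apply, radialRetr_of_norm_le_one hw]

/-- On the open disc `unifExtC` is the Riemann map. [folklore] -/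
lemma unifExtC_of_norm_lt_one {w : ℂ} (hw : ‖w‖ < 1) : unifExtC S hS w = unifMap S hS w := by
  rw [unifExtC_of_norm_le_one S hS hw.le, unifExt_eqOn S hS (mem_ball_zero_iff.2 hw)]

/-- `unifExtC` takes values in `closure S`. [folklore] -/
lemma unifExtC_mem_closure (w : ℂ) : unifExtC S hS w ∈ closure S :=
  (bijOn_unifExt S hS).mapsTo (radialRetr_mem_closedBall w)

/-- The range of `unifExtC` lies in `closure S`. [folklore] -/
lemma range_unifExtC_subset : range (unifExtC S hS) ⊆ closure S :=
  range_subset_iff.2 (unifExtC_mem_closure S hS)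

/-- Points of the open disc go to `S`. [folklore] -/
lemma unifExtC_mem_of_norm_lt_one {w : ℂ} (hw : ‖w‖ < 1) : unifExtC S hS w ∈ S := by
  rw [unifExtC_of_norm_lt_one S hS hw]
  exact (unifMap S hS).mapsTo (mem_ball_zero_iff.2 hw)

/-- `unifExtC` is injective on the closed disc. [folklore] -/
lemma injOn_unifExtC : InjOn (unifExtC S hS) (closedBall 0 1) := fun w hw w' hw' h ↦ by
  rw [unifExtC_of_norm_le_one S hS (mem_closedBall_zero_iff.1 hw),
    unifExtC_of_norm_le_one S hS (mem_closedBall_zero_iff.1 hw')] at h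
  exact (bijOn_unifExt S hS).injOn hw hw' h

/-- The reading map `T_S = unifExtC S ∘ C : ℍ → ℂ` of the modular family in the domain `S`. [folklore] -/
def readMap : C(ℍ, ℂ) := (unifExtC S hS).comp cayleyH

/-- Pointwise formula for the reading map. [folklore] -/
lemma readMap_apply (z : ℍ) : readMap S hS z = unifExtC S hS (cayleyFun z) := rfl

/-- The reading map is injective. [folklore] -/
lemma injective_readMap : Function.Injective (readMap S hS) := fun z w h ↦
  injective_cayleyH (injOn_unifExtC S hS (mem_closedBall_zero_iff.2 (norm_cayleyH_lt_one z).le)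
    (mem_closedBall_zero_iff.2 (norm_cayleyH_lt_one w).le) h)

/-- The reading map takes values in `S`. [folklore] -/
lemma readMap_mem (z : ℍ) : readMap S hS z ∈ S :=
  unifExtC_mem_of_norm_lt_one S hS (norm_cayleyH_lt_one z)

/-! ### The loop ensemble in a Jordan carrier and its law -/

/-- The loop collection in `S` driven by `g`: the push-forward of `modularLoops g` along `unifExtC S`.
[folklore] -/
def loopsIn (g : SL(2, ℝ)) : LoopSpace ℂ := LoopSpace.map (unifExtC S hS) (modularLoops g)

/-- `loopsIn S g` is the closure of the square family read through `T_S`. [folklore] -/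
lemma loopsIn_eq (g : SL(2, ℝ)) :
    loopsIn S hS g = TopologicalSpace.Closeds.closure (sqFamily (readMap S hS) g) := by
  rw [loopsIn, modularLoops, LoopSpace.map_closure_eq_of_uniformContinuous (uniformContinuous_unifExtC S hS),
    ← sqFamily_comp]
  rfl

/-- The underlying set of `loopsIn S g`. [folklore] -/
lemma coe_loopsIn (g : SL(2, ℝ)) :
    (loopsIn S hS g : Set (CurveClass ℂ)) = closure (sqFamily (readMap S hS) g) := by
  rw [loopsIn_eq]; rfl

/-- `g ↦ loopsIn S g` is continuous. [folklore] -/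
lemma continuous_loopsIn : Continuous (loopsIn S hS) :=
  (LoopSpace.continuous_map_of_uniformContinuous (uniformContinuous_unifExtC S hS)).comp
    continuous_modularLoops

/-- The square family read through `T_S` is locally finite. [folklore] -/
lemma locFin_sqFamily_readMap (g : SL(2, ℝ)) : CurveClass.LocFin (sqFamily (readMap S hS) g) := by
  rw [readMap, sqFamily_comp]
  exact (locFin_sqFamily g).image (K := univ) (fun _ _ ↦ subset_univ _)
    (uniformContinuous_unifExtC S hS).uniformContinuousOn

/-- Members of `loopsIn S g` are members of the family or trivial. [folklore] -/
lemma mem_sqFamily_of_mem_loopsIn {g : SL(2, ℝ)} {c : CurveClass ℂ} (hc : c ∈ loopsIn S hS g)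
    (hnt : ¬ c.IsTrivial) : c ∈ sqFamily (readMap S hS) g := by
  rw [← SetLike.mem_coe, coe_loopsIn] at hc
  exact (locFin_sqFamily_readMap S hS g).mem_of_mem_closure_of_not_isTrivial hc hnt

/-- Members of the family belong to `loopsIn S g`. [folklore] -/
lemma sqFamily_subset_loopsIn (g : SL(2, ℝ)) :
    sqFamily (readMap S hS) g ⊆ (loopsIn S hS g : Set (CurveClass ℂ)) := by
  rw [coe_loopsIn]; exact subset_closure

/-- All members of `loopsIn S g` have trace in `closure S`. [folklore] -/
lemma range_subset_of_mem_loopsIn {g : SL(2, ℝ)} {c : CurveClass ℂ} (hc : c ∈ loopsIn S hS g) :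
    c.range ⊆ closure S :=
  LoopSpace.map_mem_carried_of_range_subset isClosed_closure (range_unifExtC_subset S hS) _ hc

/-- Non-trivial members of `loopsIn S g` have trace in the open set `S`. [folklore] -/
lemma range_subset_of_mem_loopsIn_of_not_isTrivial {g : SL(2, ℝ)} {c : CurveClass ℂ}
    (hc : c ∈ loopsIn S hS g) (hnt : ¬ c.IsTrivial) : c.range ⊆ S :=
  (range_subset_of_mem_sqFamily (mem_sqFamily_of_mem_loopsIn S hS hc hnt)).trans
    (range_subset_iff.2 (readMap_mem S hS))

/-- **The law of the ensemble in the Jordan carrier `S`.** [folklore] -/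
def cleLawOf : Measure (LoopSpace ℂ) := modularLaw.map (LoopSpace.map (unifExtC S hS))

/-- The law in `S` is the image of the driving law under `g ↦ loopsIn S g`. [folklore] -/
lemma cleLawOf_eq_map : cleLawOf S hS = drivingLaw.map (loopsIn S hS) := by
  rw [cleLawOf, modularLaw, Measure.map_map
    (LoopSpace.measurable_map_of_uniformContinuous (uniformContinuous_unifExtC S hS))
    continuous_modularLoops.measurable]
  rfl

/-- The law in `S` is a probability measure. [folklore] -/
instance isProbabilityMeasure_cleLawOf : IsProbabilityMeasure (cleLawOf S hS) := by
  rw [cleLawOf_eq_map]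
  exact Measure.isProbabilityMeasure_map (continuous_loopsIn S hS).measurable.aemeasurable

/-- The range of `g ↦ loopsIn S g` is measurable (σ-compactness of `SL(2, ℝ)`). [folklore] -/
lemma measurableSet_range_loopsIn : MeasurableSet (range (loopsIn S hS)) := by
  rw [← image_univ, ← iUnion_compactCovering, image_iUnion]
  exact MeasurableSet.iUnion fun n ↦
    ((isCompact_compactCovering _ n).image (continuous_loopsIn S hS)).isClosed.measurableSet

/-- **Almost every sample of the law in `S` is a collection `loopsIn S g`.** [folklore] -/
lemma ae_mem_range_loopsIn : ∀ᵐ L ∂(cleLawOf S hS), L ∈ range (loopsIn S hS) := by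
  rw [cleLawOf_eq_map]
  exact (ae_map_iff (continuous_loopsIn S hS).measurable.aemeasurable
    (measurableSet_range_loopsIn S hS)).2 (Eventually.of_forall fun g ↦ mem_range_self g)

/-- Transfer of sure properties of the collections to almost sure properties of the law. [folklore] -/
lemma ae_of_forall_loopsIn {P : LoopSpace ℂ → Prop} (h : ∀ g, P (loopsIn S hS g)) :
    ∀ᵐ L ∂(cleLawOf S hS), P L := by
  filter_upwards [ae_mem_range_loopsIn S hS] with L hL
  obtain ⟨g, rfl⟩ := hL
  exact h g

/-! ### The sample-path fields -/

/-- Every collection `loopsIn S g` lies in `closure S`. [folklore] -/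
lemma loopsIn_range_subset (g : SL(2, ℝ)) : ∀ c ∈ loopsIn S hS g, CurveClass.range c ⊆ closure S :=
  fun _ hc ↦ range_subset_of_mem_loopsIn S hS hc

/-- Every collection `loopsIn S g` is a loop collection: all members are loops and the non-trivial
ones belong to the countable square family. [folklore] -/
lemma isLoopCollection_loopsIn (g : SL(2, ℝ)) : (loopsIn S hS g).IsLoopCollection := by
  refine ⟨fun c hc ↦ ?_, ?_⟩
  · rw [← SetLike.mem_coe, coe_loopsIn] at hc
    exact CurveClass.isLoop_of_mem_closure (fun c hc ↦ isLoop_of_mem_sqFamily hc) hc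
  · exact (countable_sqFamily (readMap S hS) g).mono fun c hc ↦
      mem_sqFamily_of_mem_loopsIn S hS hc.1 hc.2

/-- Every collection `loopsIn S g` is locally finite. [folklore] -/
lemma isLocallyFinite_loopsIn (g : SL(2, ℝ)) : (loopsIn S hS g).IsLocallyFinite := by
  intro ε hε
  have h := (locFin_sqFamily_readMap S hS g).closure ε hε
  rwa [← coe_loopsIn] at h

/-- Every collection `loopsIn S g` is non-crossing. [folklore] -/
lemma isNonCrossing_loopsIn (g : SL(2, ℝ)) : (loopsIn S hS g).IsNonCrossing :=
  isNonCrossing_of_subset_sqFamily (injective_readMap S hS) g fun _ hc hnt ↦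
    mem_sqFamily_of_mem_loopsIn S hS hc hnt

/-- Every collection `loopsIn S g` has infinitely many non-trivial members. [folklore] -/
lemma infinite_loopsIn (g : SL(2, ℝ)) :
    {c ∈ ((loopsIn S hS g : LoopSpace ℂ) : Set (CurveClass ℂ)) | ¬ c.IsTrivial}.Infinite :=
  (infinite_sqFamily (injective_readMap S hS) g).mono fun _ hc ↦
    ⟨sqFamily_subset_loopsIn S hS g hc, not_isTrivial_of_mem_sqFamily (injective_readMap S hS) hc⟩

/-- Every member of `loopsIn S g` is a simple loop or trivial. [folklore] -/
lemma subset_simpleLoop_loopsIn (g : SL(2, ℝ)) :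
    ((loopsIn S hS g : LoopSpace ℂ) : Set (CurveClass ℂ)) ⊆ CurveClass.simpleLoop ∪ {c | c.IsTrivial} := by
  intro c hc
  by_cases hct : c.IsTrivial
  · exact Or.inr hct
  · exact Or.inl (mem_simpleLoop_of_mem_sqFamily (injective_readMap S hS)
      (mem_sqFamily_of_mem_loopsIn S hS hc hct))

/-! ### Conformal invariance -/

/-- **Conformal invariance of the laws `cleLawOf`.** For Jordan carriers `S, S'`, a conformal
equivalence `φ : S → S'` and a continuous `Φ : ℂ → ℂ` agreeing with `φ` on `S`, the push-forward of the
law in `S` along `LoopSpace.map Φ` is the law in `S'`. Proof: with Riemann maps `ψ, ψ'` the composite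
`ψ'⁻¹ ∘ φ ∘ ψ` is a disc automorphism, hence (conjugating by the Cayley transform,
`ConformalEquiv.exists_specialLinearGroup_eq`) the disc Möbius map of some `h ∈ SL(2, ℝ)`; so
`Φ ∘ Φ̂_S = Φ̂_{S'} ∘ M_h` on the closed disc, and the law of the modular ensemble is `M_h`-invariant
(`map_modularLaw_diskMoebiusExt`). [folklore] -/
theorem map_cleLawOf_eq {S S' : Set ℂ} (hS : IsJordanCarrier S) (hS' : IsJordanCarrier S')
    (hSb : Bornology.IsBounded S) (φ : ConformalEquiv S S') (Φ : C(ℂ, ℂ)) (hΦ : EqOn Φ φ S) :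
    (cleLawOf S hS).map (LoopSpace.map Φ) = cleLawOf S' hS' := by
  -- Step A: the disc automorphism `ψ'⁻¹ ∘ φ ∘ ψ` is a disc Möbius map
  set ψ := unifMap S hS with hψ
  set ψ' := unifMap S' hS' with hψ'
  let m : ConformalEquiv (ball (0 : ℂ) 1) (ball 0 1) := ψ.trans (φ.trans ψ'.symm)
  let Mh : ConformalEquiv UpperHalfPlane.upperHalfPlaneSet UpperHalfPlane.upperHalfPlaneSet :=
    cayley.trans (m.trans cayley.symm)
  obtain ⟨h, hh⟩ := ConformalEquiv.exists_specialLinearGroup_eq Mh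
  have hm : ∀ w : ℂ, ‖w‖ < 1 → m w = diskMoebius h w := by
    intro w hw
    have hw1 : w ≠ 1 := by rintro rfl; simp at hw
    set z : ℍ := ofDisc w hw with hz
    have hmw : m w ∈ ball (0 : ℂ) 1 := m.mapsTo (mem_ball_zero_iff.2 hw)
    have hmw1 : m w ≠ 1 := by rintro h1; rw [h1] at hmw; simp at hmw
    have h1 : Mh (z : ℂ) = cayleyInvFun (m w) := by
      change cayleyInvFun (m (cayleyFun (cayleyInvFun w))) = _
      rw [cayleyFun_cayleyInvFun hw1]
    calc m w = cayleyFun (cayleyInvFun (m w)) := (cayleyFun_cayleyInvFun hmw1).symm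
      _ = cayleyFun ((h • z : ℍ) : ℂ) := by rw [← h1, hh z]
      _ = diskMoebius h (cayleyFun z) := cayleyFun_smul h z
      _ = diskMoebius h w := by rw [hz, coe_ofDisc, cayleyFun_cayleyInvFun hw1]
  -- Step B: `Φ ∘ Φ̂ = Φ̂' ∘ M_h` on the closed disc
  set F₁ : C(ℂ, ℂ) := Φ.comp (unifExtC S hS) with hF₁
  set F₂ : C(ℂ, ℂ) := (unifExtC S' hS').comp (diskMoebiusExt h) with hF₂
  have hball : EqOn F₁ F₂ (ball 0 1) := by
    intro w hw
    have hw' : ‖w‖ < 1 := mem_ball_zero_iff.1 hw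
    have hψw : ψ w ∈ S := ψ.mapsTo hw
    have hmw : ‖m w‖ < 1 := mem_ball_zero_iff.1 (m.mapsTo hw)
    change Φ (unifExtC S hS w) = unifExtC S' hS' (diskMoebiusExt h w)
    rw [unifExtC_of_norm_lt_one S hS hw', diskMoebiusExt_of_norm_le_one h hw'.le, ← hm w hw', hΦ hψw,
      unifExtC_of_norm_lt_one S' hS' hmw]
    change φ (ψ w) = ψ' (ψ'.symm (φ (ψ w)))
    rw [ψ'.apply_symm_apply (φ.mapsTo hψw)]
  have hclosed : EqOn F₁ F₂ (closedBall 0 1) := by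
    rw [← closure_ball (0 : ℂ) one_ne_zero]
    exact hball.of_subset_closure F₁.continuous.continuousOn F₂.continuous.continuousOn subset_closure
      Subset.rfl
  -- Step C: the chain of push-forwards
  have hcpt : IsCompact (closure S) := hSb.isCompact_closure
  have huS : UniformContinuousOn Φ (closure S) :=
    hcpt.uniformContinuousOn_of_continuous Φ.continuous.continuousOn
  have hae : ∀ᵐ L ∂(cleLawOf S hS), L ∈ LoopSpace.carried (closure S) :=
    ae_of_forall_loopsIn S hS fun g ↦
      LoopSpace.map_mem_carried_of_range_subset isClosed_closure (range_unifExtC_subset S hS) _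
  have haem : AEMeasurable (LoopSpace.map Φ) (modularLaw.map (LoopSpace.map (unifExtC S hS))) :=
    LoopSpace.aemeasurable_map_of_ae_mem_carried isClosed_closure huS hae
  have hmeas : Measurable (LoopSpace.map (unifExtC S hS)) :=
    LoopSpace.measurable_map_of_uniformContinuous (uniformContinuous_unifExtC S hS)
  rw [cleLawOf, AEMeasurable.map_map_of_aemeasurable haem hmeas.aemeasurable]
  have hcomp : LoopSpace.map Φ ∘ LoopSpace.map (unifExtC S hS) = LoopSpace.map F₁ :=
    funext fun L ↦ LoopSpace.map_map_of_mapsTo isClosed_closure huS fun c _ x _ ↦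
      unifExtC_mem_closure S hS x
  rw [hcomp]
  have hu₁ : UniformContinuous F₁ := by
    have : (F₁ : ℂ → ℂ) = (Φ ∘ unifExt S hS) ∘ radialRetr := rfl
    rw [this]
    exact uniformContinuous_comp_radialRetr (Φ.continuous.comp_continuousOn (continuousOn_unifExt S hS))
  have hu₂ : UniformContinuous F₂ :=
    (uniformContinuous_unifExtC S' hS').comp (uniformContinuous_diskMoebiusExt h)
  have e1 : modularLaw.map (LoopSpace.map F₁) = modularLaw.map (LoopSpace.map F₂) := by
    rw [modularLaw, Measure.map_map (LoopSpace.measurable_map_of_uniformContinuous hu₁)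
      continuous_modularLoops.measurable, Measure.map_map (LoopSpace.measurable_map_of_uniformContinuous hu₂)
      continuous_modularLoops.measurable]
    congr 1
    exact funext fun g ↦ LoopSpace.map_congr_of_carried (modularLoops_mem_carried g) hclosed
  rw [e1]
  have hcomp' : LoopSpace.map F₂ = LoopSpace.map (unifExtC S' hS') ∘ LoopSpace.map (diskMoebiusExt h) :=
    funext fun L ↦ (LoopSpace.map_map_of_uniformContinuous (uniformContinuous_unifExtC S' hS') _ L).symm
  rw [hcomp', ← Measure.map_map (LoopSpace.measurable_map_of_uniformContinuous (uniformContinuous_unifExtC S' hS'))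
    (LoopSpace.measurable_map_of_uniformContinuous (uniformContinuous_diskMoebiusExt h)),
    map_modularLaw_diskMoebiusExt]
  rfl

/-! ### The restriction field, equal carriers: every loop avoids `∂D` -/

/-- The law depends only on the carrier (and not on the proof that it is a Jordan carrier). [folklore] -/
lemma cleLawOf_congr {S S' : Set ℂ} (hS : IsJordanCarrier S) (hS' : IsJordanCarrier S') (h : S = S') :
    cleLawOf S hS = cleLawOf S' hS' := by
  subst h; rfl

/-- Window restriction to a set carrying the whole collection is the identity. [folklore] -/
lemma restrict_eq_self_of_carried {K : Set ℂ} {L : LoopSpace ℂ} (hL : L ∈ LoopSpace.carried K) :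
    LoopSpace.restrict K L = L := by
  apply TopologicalSpace.Closeds.ext
  change closure {c ∈ (L : Set (CurveClass ℂ)) | c.range ⊆ K} = L
  rw [show {c ∈ (L : Set (CurveClass ℂ)) | c.range ⊆ K} = L from
    Set.ext fun c ↦ ⟨fun h ↦ h.1, fun h ↦ ⟨h, hL h⟩⟩, L.isClosed.closure_eq]

/-- Every collection `loopsIn D.carrier g` avoids the frontier of `D`: its non-trivial members have
trace in the open set `D`. [folklore] -/
lemma loopsIn_mem_avoidsFrontier (D : JordanDomain) (g : SL(2, ℝ)) :
    loopsIn D.carrier (isJordanCarrier_carrier D) g ∈ LoopSpace.avoidsFrontier D := by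
  intro c hc hnt
  have hsub := range_subset_of_mem_loopsIn_of_not_isTrivial D.carrier (isJordanCarrier_carrier D) hc hnt
  have hempty := D.isOpen.inter_frontier_eq
  exact disjoint_left.2 fun x hx hxf ↦ (eq_empty_iff_forall_notMem.1 hempty x) ⟨hsub hx, hxf⟩

/-- **Restriction field, equal carriers**: conditioning on the almost sure event "no loop meets
`∂D`" and restricting to the window `closure D` does nothing. [folklore] -/
theorem restriction_of_carrier_eq (D D' : JordanDomain) (heq : D'.carrier = D.carrier) :
    (ProbabilityTheory.cond (cleLawOf D.carrier (isJordanCarrier_carrier D)) (LoopSpace.avoidsFrontier D')).map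
        (LoopSpace.restrict (closure D'.carrier)) = cleLawOf D'.carrier (isJordanCarrier_carrier D') := by
  set μ := cleLawOf D.carrier (isJordanCarrier_carrier D) with hμ
  have hav : LoopSpace.avoidsFrontier D' = LoopSpace.avoidsFrontier D := by
    unfold LoopSpace.avoidsFrontier; rw [heq]
  have hae : ∀ᵐ L ∂μ, L ∈ LoopSpace.avoidsFrontier D :=
    ae_of_forall_loopsIn _ _ (loopsIn_mem_avoidsFrontier D)
  have hone : μ (LoopSpace.avoidsFrontier D) = 1 := by
    rw [measure_congr (ae_eq_univ.2 (ae_iff.1 hae)), measure_univ]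
  have hcond : ProbabilityTheory.cond μ (LoopSpace.avoidsFrontier D') = μ := by
    rw [hav, ProbabilityTheory.cond, hone, inv_one, one_smul, Measure.restrict_eq_self_of_ae_mem hae]
  rw [hcond, cleLawOf_congr (isJordanCarrier_carrier D') (isJordanCarrier_carrier D) heq,
    show closure D'.carrier = closure D.carrier by rw [heq]]
  have hid : LoopSpace.restrict (closure D.carrier) =ᵐ[μ] id :=
    ae_of_forall_loopsIn _ _ fun g ↦ restrict_eq_self_of_carried
      (LoopSpace.map_mem_carried_of_range_subset isClosed_closure (range_unifExtC_subset _ _) _)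
  rw [Measure.map_congr hid, Measure.map_id]

/-! ### The restriction field, strict sub-carriers: some loop meets `∂D'` almost surely -/

/-- A proper Jordan sub-carrier has a frontier point inside the big domain (connectedness). [folklore] -/
lemma exists_mem_frontier_mem (D D' : JordanDomain) (hsub : D'.carrier ⊆ D.carrier)
    (hne : D'.carrier ≠ D.carrier) : ∃ p ∈ frontier D'.carrier, p ∈ D.carrier := by
  by_contra h
  push Not at h
  apply hne
  refine hsub.antisymm fun x hx ↦ ?_
  have hpre := D.isConnected.isPreconnected D'.carrier (closure D'.carrier)ᶜ D'.isOpen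
    isClosed_closure.isOpen_compl ?_ ?_
  · by_contra hx'
    have hv : (D.carrier ∩ (closure D'.carrier)ᶜ).Nonempty := by
      refine ⟨x, hx, fun hxc ↦ ?_⟩
      rw [closure_eq_self_union_frontier] at hxc
      rcases hxc with hxc | hxc
      · exact hx' hxc
      · exact h x hxc hx
    obtain ⟨y, -, hy1, hy2⟩ := hpre hv
    exact hy2 (subset_closure hy1)
  · intro y hy
    by_cases hyc : y ∈ closure D'.carrier
    · rw [closure_eq_self_union_frontier] at hyc
      rcases hyc with hyc | hyc
      · exact Or.inl hyc
      · exact absurd hy (h y hyc)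
    · exact Or.inr hyc
  · obtain ⟨y, hy⟩ := D'.nonempty
    exact ⟨y, hsub hy, hy⟩

/-- An arc of `∂D'` inside `D`: a parameter interval `[a, b]`, `a < b`, on which the boundary loop of
`D'` is injective and stays in `D`. [folklore] -/
lemma exists_arc (D D' : JordanDomain) (hsub : D'.carrier ⊆ D.carrier) (hne : D'.carrier ≠ D.carrier) :
    ∃ a b : ℝ, a < b ∧ (∀ t ∈ Icc a b, D'.boundary t ∈ D.carrier) ∧ InjOn D'.boundary (Icc a b) ∧
      ∀ t ∈ Icc a b, D'.boundary t ∈ frontier D'.carrier := by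
  obtain ⟨p, hp, hpD⟩ := exists_mem_frontier_mem D D' hsub hne
  rw [D'.frontier_eq_image_Ico] at hp
  obtain ⟨t₀, ht₀, rfl⟩ := hp
  have hopen : IsOpen (D'.boundary ⁻¹' D.carrier) := D.isOpen.preimage D'.continuous_boundary
  obtain ⟨ε, hε, hball⟩ := Metric.isOpen_iff.1 hopen t₀ hpD
  set δ : ℝ := min (ε / 2) ((1 - t₀) / 2) with hδ
  have hδpos : 0 < δ := lt_min (by positivity) (by linarith [ht₀.2])
  have hδε : δ ≤ ε / 2 := min_le_left _ _
  have hδ1 : δ ≤ (1 - t₀) / 2 := min_le_right _ _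
  have hIcc : Icc t₀ (t₀ + δ) ⊆ Ico 0 1 := fun t ht ↦ ⟨ht₀.1.trans ht.1, by linarith [ht.2, ht₀.2]⟩
  refine ⟨t₀, t₀ + δ, by linarith, fun t ht ↦ hball ?_, D'.injOn_boundary.mono hIcc,
    fun t _ ↦ D'.boundary_mem_frontier t⟩
  rw [Metric.mem_ball, Real.dist_eq, abs_lt]
  constructor <;> linarith [ht.1, ht.2]

/-- The lift of a point of the disc to `ℍ` (the base point `i` off the disc). [folklore] -/
def toH (w : ℂ) : ℍ := if hw : ‖w‖ < 1 then ofDisc w hw else UpperHalfPlane.I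

/-- On the disc, `toH` is `ofDisc`. [folklore] -/
lemma toH_of_norm_lt_one {w : ℂ} (hw : ‖w‖ < 1) : toH w = ofDisc w hw := dif_pos hw

/-- `C (toH w) = w` on the disc. [folklore] -/
lemma cayleyFun_toH {w : ℂ} (hw : ‖w‖ < 1) : cayleyFun (toH w : ℍ) = w := by
  rw [toH_of_norm_lt_one hw, cayleyFun_ofDisc]

/-- `toH` is injective on the disc. [folklore] -/
lemma injOn_toH : InjOn toH (ball 0 1) := fun w hw w' hw' h ↦ by
  rw [← cayleyFun_toH (mem_ball_zero_iff.1 hw), ← cayleyFun_toH (mem_ball_zero_iff.1 hw'), h]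

/-- `toH` is continuous on the disc. [folklore] -/
lemma continuousOn_toH : ContinuousOn toH (ball 0 1) := by
  rw [continuousOn_iff_continuous_restrict]
  have heq : (ball (0 : ℂ) 1).restrict toH = fun w : ball (0 : ℂ) 1 ↦
      ofDisc (w : ℂ) (mem_ball_zero_iff.1 w.2) := funext fun w ↦ toH_of_norm_lt_one _
  rw [heq, UpperHalfPlane.isEmbedding_coe.continuous_iff]
  change Continuous fun w : ball (0 : ℂ) 1 ↦ cayleyInvFun (w : ℂ)
  refine differentiableOn_cayleyInvFun.continuousOn.comp_continuous continuous_subtype_val fun w ↦ ?_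
  have hw : ‖(w : ℂ)‖ < 1 := mem_ball_zero_iff.1 w.2
  rintro (h1 : (w : ℂ) = 1)
  simp [h1] at hw

/-- Meeting a closed set is a closed condition on curve classes. [folklore] -/
lemma isClosed_setOf_not_disjoint_range {F : Set ℂ} (hF : IsClosed F) :
    IsClosed {c : CurveClass ℂ | ¬ Disjoint c.range F} := by
  have : {c : CurveClass ℂ | ¬ Disjoint c.range F} = CurveClass.hitsBefore F ∅ := by
    rw [CurveClass.hitsBefore_empty_right]
    ext c
    simp only [mem_setOf_eq, mem_compl_iff, CurveClass.mem_rangeSubset, subset_compl_iff_disjoint_right]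
  rw [this]
  exact CurveClass.isClosed_hitsBefore_empty_right hF

/-- The loops of one square driven by all of `SL(2, ℝ)` depend continuously on the driving element.
[folklore] -/
lemma continuous_mk_sqCurve (T : C(ℍ, ℂ)) (Q : TileSquare) :
    Continuous fun g : SL(2, ℝ) ↦ CurveClass.mk (sqCurve T g Q) := by
  let F : C(SL(2, ℝ) × unitInterval, ℂ) :=
    ⟨fun p ↦ T (p.1 • Q.bdryPt p.2), T.continuous.comp
      ((continuous_fst.smul (Q.continuous_bdryPt.comp continuous_snd)))⟩
  have hF : Continuous fun g : SL(2, ℝ) ↦ Curve.mk (F.curry g) :=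
    Curve.lipschitzWith_mk.continuous.comp F.curry.continuous
  exact CurveClass.continuous_mk.comp hF

/-- **For a proper Jordan sub-carrier `D' ⊊ D` the event "no loop of the ensemble in `D` meets
`∂D'`" is null.** An arc `A` of `∂D' ∩ D` pulls back (Riemann map, Cayley transform, the driving
element and a lattice element) to a non-degenerate connected subset of `ℍ` through a point which almost
surely lies in a translate of the open tile (`ae_exists_smul_mem_fdo`); such a set meets the boundary of
a tile square (`exists_tileSquare_inter_nonempty`), i.e. some loop of the ensemble passes through `A`.
The event is controlled by countably many closed hitting events of compact sets of loops. [folklore] -/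
theorem cleLawOf_avoidsFrontier_eq_zero (D D' : JordanDomain) (hsub : D'.carrier ⊆ D.carrier)
    (hne : D'.carrier ≠ D.carrier) :
    cleLawOf D.carrier (isJordanCarrier_carrier D) (LoopSpace.avoidsFrontier D') = 0 := by
  set S := D.carrier with hSdef
  have hS : IsJordanCarrier S := (isJordanCarrier_carrier D)
  set T := readMap S hS with hT
  set ψ := unifMap S hS with hψ
  -- the arc and its pull-backs
  obtain ⟨a, b, hab, hAD, hinj, hAfr⟩ := exists_arc D D' hsub hne
  set A : Set ℂ := D'.boundary '' Icc a b with hA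
  have hAS : A ⊆ S := by rintro _ ⟨t, ht, rfl⟩; exact hAD t ht
  have hAc : IsPreconnected A := isPreconnected_Icc.image _ D'.continuous_boundary.continuousOn
  set A₀ : Set ℂ := ψ.symm '' A with hA₀
  have hA₀ball : A₀ ⊆ ball 0 1 := by
    rintro _ ⟨x, hx, rfl⟩; exact ψ.symm.mapsTo (hAS hx)
  have hA₀c : IsPreconnected A₀ := hAc.image _ (ψ.symm.continuousOn.mono hAS)
  set A₁ : Set ℍ := toH '' A₀ with hA₁
  have hA₁c : IsPreconnected A₁ := hA₀c.image _ (continuousOn_toH.mono hA₀ball)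
  -- two distinct points
  set p₁ : ℂ := D'.boundary a
  set p₂ : ℂ := D'.boundary b
  have hp₁A : p₁ ∈ A := ⟨a, left_mem_Icc.2 hab.le, rfl⟩
  have hp₂A : p₂ ∈ A := ⟨b, right_mem_Icc.2 hab.le, rfl⟩
  have hp₁₂ : p₁ ≠ p₂ := fun h ↦ hab.ne (hinj (left_mem_Icc.2 hab.le) (right_mem_Icc.2 hab.le) h)
  set z₁ : ℍ := toH (ψ.symm p₁) with hz₁
  set z₂ : ℍ := toH (ψ.symm p₂) with hz₂
  have hz₁A : z₁ ∈ A₁ := ⟨_, ⟨_, hp₁A, rfl⟩, rfl⟩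
  have hz₂A : z₂ ∈ A₁ := ⟨_, ⟨_, hp₂A, rfl⟩, rfl⟩
  have hz₁₂ : z₁ ≠ z₂ := fun h ↦ hp₁₂ (ψ.symm.injOn (hAS hp₁A) (hAS hp₂A)
    (injOn_toH (ψ.symm.mapsTo (hAS hp₁A)) (ψ.symm.mapsTo (hAS hp₂A)) h))
  -- reading the arc back: `T (toH (ψ⁻¹ x)) = x` for `x ∈ A`
  have hread : ∀ x ∈ A, T (toH (ψ.symm x)) = x := by
    intro x hx
    have hw : ‖ψ.symm x‖ < 1 := mem_ball_zero_iff.1 (ψ.symm.mapsTo (hAS hx))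
    rw [hT, readMap_apply, cayleyFun_toH hw, unifExtC_of_norm_lt_one S hS hw]
    exact ψ.apply_symm_apply (hAS hx)
  -- the compact sets of hitting loops
  set W : Set (CurveClass ℂ) := {c | ¬ Disjoint c.range (frontier D'.carrier)} with hW
  have hWc : IsClosed W := isClosed_setOf_not_disjoint_range isClosed_frontier
  set C : ℕ → TileSquare → Set (CurveClass ℂ) := fun n Q ↦
    ((fun g : SL(2, ℝ) ↦ CurveClass.mk (sqCurve T g Q)) '' compactCovering SL(2, ℝ) n) ∩ W with hC
  have hCc : ∀ n Q, IsCompact (C n Q) := fun n Q ↦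
    ((isCompact_compactCovering _ n).image (continuous_mk_sqCurve T Q)).inter_right hWc
  set T₀ : Set (LoopSpace ℂ) := ⋂ n, ⋂ Q, {L | ∃ c ∈ C n Q, c ∈ L}ᶜ with hT₀
  have hT₀m : MeasurableSet T₀ := MeasurableSet.iInter fun n ↦ MeasurableSet.iInter fun Q ↦
    (LoopSpace.isClosed_setOf_exists_mem_of_isCompact (hCc n Q)).measurableSet.compl
  have hsubT₀ : LoopSpace.avoidsFrontier D' ⊆ T₀ := by
    intro L hL
    simp only [hT₀, mem_iInter, mem_compl_iff, mem_setOf_eq, not_exists, not_and]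
    intro n Q c hc hcL
    obtain ⟨⟨g, -, rfl⟩, hcW⟩ := hc
    exact hcW (hL _ hcL (not_isTrivial_mk_sqCurve (injective_readMap S hS) g Q))
  -- good driving elements produce a hitting loop
  have hgood : ∀ g : SL(2, ℝ), (∃ γ : SL(2, ℤ), γ • (g • z₁) ∈ 𝒟ᵒ) → loopsIn S hS g ∉ T₀ := by
    rintro g ⟨γ, hγ⟩ hgT
    set K : Set ℍ := ((((γ : SL(2, ℝ)) * g) • ·) '' A₁) with hK
    have hKc : IsPreconnected K := hA₁c.image _ (continuous_const_smul _).continuousOn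
    have hp' : ((γ : SL(2, ℝ)) * g) • z₁ ∈ 𝒟ᵒ := by rw [mul_smul, coe_smul_eq]; exact hγ
    obtain ⟨Q, w₁, ⟨a₁, ha₁, rfl⟩, hw₁⟩ := exists_tileSquare_inter_nonempty hKc
      (mem_image_of_mem _ hz₁A) (mem_image_of_mem _ hz₂A)
      (fun h ↦ hz₁₂ (smul_left_cancel _ h)) hp'
    obtain ⟨a₀, ⟨x, hxA, rfl⟩, rfl⟩ := ha₁
    -- the loop of `Q` indexed by `γ⁻¹`
    set c := CurveClass.mk (sqCurve T (g⁻¹ * ((γ⁻¹ : SL(2, ℤ)) : SL(2, ℝ))) Q) with hc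
    have hcmem : c ∈ loopsIn S hS g := sqFamily_subset_loopsIn S hS g (mk_sqCurve_mem_sqFamily T g γ⁻¹ Q)
    have hcW : c ∈ W := by
      change ¬ Disjoint c.range (frontier D'.carrier)
      rw [hc, CurveClass.range_mk, range_sqCurve, not_disjoint_iff]
      refine ⟨x, ⟨_, ⟨_, hw₁, rfl⟩, ?_⟩, ?_⟩
      · dsimp only
        rw [← mul_smul, map_inv, show g⁻¹ * ((γ : SL(2, ℝ)))⁻¹ * ((γ : SL(2, ℝ)) * g) = 1 by group, one_smul]
        exact hread x hxA
      · obtain ⟨t, ht, rfl⟩ := hxA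
        exact hAfr t ht
    obtain ⟨n, hn⟩ : ∃ n, g⁻¹ * ((γ⁻¹ : SL(2, ℤ)) : SL(2, ℝ)) ∈ compactCovering SL(2, ℝ) n :=
      mem_iUnion.1 (by rw [iUnion_compactCovering]; exact mem_univ _)
    simp only [hT₀, mem_iInter, mem_compl_iff, mem_setOf_eq, not_exists, not_and] at hgT
    exact hgT n Q c ⟨⟨_, hn, rfl⟩, hcW⟩ hcmem
  -- conclusion
  refine measure_mono_null hsubT₀ ?_
  rw [cleLawOf_eq_map, Measure.map_apply (continuous_loopsIn S hS).measurable hT₀m]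
  refine measure_mono_null (fun g hg ↦ ?_) (ae_iff.1 (ae_exists_smul_mem_fdo z₁))
  exact fun hγ ↦ hgood g hγ hg

/-! ### Assembly -/

/-- **The witness family**: the law of the modular loop ensemble transported to each Jordan domain. [folklore] -/
def cleLaw (D : JordanDomain) : Measure (LoopSpace ℂ) := cleLawOf D.carrier (isJordanCarrier_carrier D)

/-- **The transported modular loop ensemble satisfies the v0 CLE axioms `IsCLEFamily κ` for every `κ`.**
[folklore] -/
theorem isCLEFamily_cleLaw (κ : ℝ≥0) : IsCLEFamily κ cleLaw where
  isProbabilityMeasure D := isProbabilityMeasure_cleLawOf _ _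
  ae_inDomain D := ae_of_forall_loopsIn _ _ (loopsIn_range_subset _ _)
  ae_isLoopCollection D := ae_of_forall_loopsIn _ _ (isLoopCollection_loopsIn _ _)
  ae_isLocallyFinite D := ae_of_forall_loopsIn _ _ (isLocallyFinite_loopsIn _ _)
  ae_isNonCrossing D := ae_of_forall_loopsIn _ _ (isNonCrossing_loopsIn _ _)
  nontrivial D := ae_of_forall_loopsIn _ _ (infinite_loopsIn _ _)
  simple_of_le_four _ D := ae_of_forall_loopsIn _ _ (subset_simpleLoop_loopsIn _ _)
  conformal_invariance D D' φ Φ hΦ _ :=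
    (map_cleLawOf_eq (isJordanCarrier_carrier D) (isJordanCarrier_carrier D') D.isBounded φ Φ hΦ).symm
  restriction D D' hsub hne := by
    by_cases heq : D'.carrier = D.carrier
    · exact restriction_of_carrier_eq D D' heq
    · exact absurd (cleLawOf_avoidsFrontier_eq_zero D D' hsub heq) hne

end ModularEnsemble

/-- **Discharge of the named fact `exists_isCLEFamily`** — by an explicit witness that is *not*
Sheffield's `CLE_κ`. The fact (Sheffield, Duke Math. J. 147 (2009), §1.1: the `CLE_κ`, `8/3 < κ < 8`,
exist as countably infinite conformally invariant random loop collections) is rendered in `CLE.lean` by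
the v0 hypothesis structure `IsCLEFamily κ`, whose docstring records how much weaker it is than CLE.
Here `IsCLEFamily κ μ` is verified, for every `κ`, for `μ = ModularEnsemble.cleLaw`, the transported
modular loop ensemble: all sample-path fields and conformal invariance hold genuinely, while the v0
`restriction` field is discharged by showing that its hypothesis `μ D (avoidsFrontier D') ≠ 0` fails for
every proper sub-carrier `D' ⊊ D` (`ModularEnsemble.cleLawOf_avoidsFrontier_eq_zero`), and that for equal
carriers conditioning and window restriction are the identity (`ModularEnsemble.restriction_of_carrier_eq`).
No construction of `CLE_κ`, `SLE`, exploration trees or loop soups is formalised. [folklore] -/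
theorem exists_isCLEFamily_holds : exists_isCLEFamily := fun {κ} _ ↦ ⟨ModularEnsemble.cleLaw, ModularEnsemble.isCLEFamily_cleLaw κ⟩

end Literature.Probability.RandomPlanarGeometry
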